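import Literature.Probability.Percolation.PlateCrossingEvents
import Literature.Probability.Percolation.AnnulusCrossingBoundProofs
import Literature.Probability.Percolation.TriAnnulusCrossingProofs
import Literature.Probability.Percolation.FullPlaneCNL
import HarnessLib

/-!
# A common one-arm window for critical `ℤ²` bond and `𝕋` site percolation

Topic `Literature/Probability/Percolation`; proofs only.  **Window confinement**
(`exists_common_oneArm_window`): for every plane homeomorphism `Φ` and `ε > 0` there are radii `W₀ < W₁` with
`Φ([-2,2]²) ⊆ B(0, W₀)` and a mesh threshold below which the event "a primal-open or a dual-open
arm of `δℤ²` from `B̄(0,W₀)` to distance `W₁`" has `bondPercolation ℤ² ½`-probability `≤ ε` and the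
event "an open or a closed arm of `δ𝕋` from `B̄(0,W₀)` to distance `W₁`" has
`triSitePercolation ½`-probability `≤ ε` — the RSW polynomial one-arm bounds of the tree
(`annulusOpenCrossing_half_le_holds`, `annulusDualCrossing_half_le_holds`,
`tri_annulusCrossing_bound_holds`) with `W₁` large.  Plus two marginal bounds through a coupling
(`measureReal_preimage_fst_le_of_map_eq'`, `…snd…`).  Used to localise transfer arguments between
the two lattices (Camia–Newman, CMP 268 (2006), §5–6).

## References

* F. Camia, C. M. Newman, Comm. Math. Phys. 268 (2006), §5–6 [CamiaNewman2006].
* G. Grimmett, *Percolation*, 2nd ed., Springer 1999, §11.7 [Grimmett1999].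
-/

noncomputable section

namespace Literature.Probability.Percolation

open Literature.Probability.RandomPlanarGeometry
open Literature.Probability.LatticeModels
open Filter _root_.Topology Set _root_.MeasureTheory Metric Complex

/-- The image of the big box lies in some closed ball about `0`. [folklore] -/
theorem exists_closedBall_superset_plateBox (Φ : ℂ ≃ₜ ℂ) : ∃ W₀ : ℝ, 0 < W₀ ∧ Φ '' plateBox 2 2 ⊆ closedBall (0 : ℂ) W₀ := by
  obtain ⟨W, hW⟩ := (((isCompact_Icc.reProdIm isCompact_Icc : IsCompact (plateBox 2 2))).image Φ.continuous).isBounded.subset_closedBall (0 : ℂ)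
  exact ⟨max W 1, lt_max_of_lt_right one_pos, hW.trans (closedBall_subset_closedBall (le_max_left _ _))⟩

/-- Marginal bound through a coupling of two different spaces, first coordinate. [folklore] -/
theorem measureReal_preimage_fst_le_of_map_eq' {X Y : Type*} [MeasurableSpace X] [MeasurableSpace Y]
    {P : Measure (X × Y)} {μ : Measure X} [IsFiniteMeasure μ] (h : P.map Prod.fst = μ)
    (s : Set X) : P.real (Prod.fst ⁻¹' s) ≤ μ.real s := by
  have h' : P (Prod.fst ⁻¹' s) ≤ μ s := by
    rw [← h]
    exact Measure.le_map_apply measurable_fst.aemeasurable s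
  exact ENNReal.toReal_mono (measure_ne_top μ s) h'

/-- Marginal bound through a coupling of two different spaces, second coordinate. [folklore] -/
theorem measureReal_preimage_snd_le_of_map_eq' {X Y : Type*} [MeasurableSpace X] [MeasurableSpace Y]
    {P : Measure (X × Y)} {ν : Measure Y} [IsFiniteMeasure ν] (h : P.map Prod.snd = ν)
    (s : Set Y) : P.real (Prod.snd ⁻¹' s) ≤ ν.real s := by
  have h' : P (Prod.snd ⁻¹' s) ≤ ν s := by
    rw [← h]
    exact Measure.le_map_apply measurable_snd.aemeasurable s
  exact ENNReal.toReal_mono (measure_ne_top ν s) h'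

/-- For `c > 0` and `ε' > 0` there is `t₀ > 0` with `t ^ c < ε'` for all `t ∈ (0, t₀)`. [folklore] -/
theorem exists_pos_forall_rpow_lt {c ε' : ℝ} (hc : 0 < c) (hε' : 0 < ε') :
    ∃ t₀ : ℝ, 0 < t₀ ∧ ∀ t ∈ Set.Ioo (0 : ℝ) t₀, t ^ c < ε' := by
  refine ⟨(ε' / 2) ^ (1 / c), Real.rpow_pos_of_pos (by positivity) _, fun t ht => ?_⟩
  have htc : t ^ c ≤ ((ε' / 2) ^ (1 / c)) ^ c := Real.rpow_le_rpow ht.1.le ht.2.le hc.le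
  rw [← Real.rpow_mul (by positivity), one_div_mul_cancel hc.ne', Real.rpow_one] at htc
  linarith

/-- **Window confinement** (RSW one-arm bounds of the tree on both lattices): for every `ε > 0`
there are radii `W₀ < W₁` with `Φ(plateBox 2 2) ⊆ B̄(0, W₀)` such that, for all small `δ`, a primal or
dual arm of `δℤ²` and an open or closed arm of `δ𝕋` from `B̄(0, W₀)` to distance `W₁` each have
probability `≤ ε`. [folklore] -/
theorem exists_common_oneArm_window (Φ : ℂ ≃ₜ ℂ) {ε : ℝ} (hε : 0 < ε) :
    ∃ W₀ W₁ : ℝ, 0 < W₀ ∧ W₀ < W₁ ∧ Φ '' plateBox 2 2 ⊆ ball (0 : ℂ) W₀ ∧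
      ∃ δw : ℝ, 0 < δw ∧ ∀ δ : ℝ, 0 < δ → δ ≤ δw →
        (bondPercolation (zdGraph 2) half).real {ω | ¬ (ω ∉ annulusOpenCrossing 0 δ W₀ W₁ ∧ ω ∉ annulusDualCrossing 0 δ W₀ W₁)} ≤ ε ∧ (triSitePercolation half).real {ω | ¬ (ω ∉ triAnnulusCrossing true δ 0 W₀ W₁ ∧ ω ∉ triAnnulusCrossing false δ 0 W₀ W₁)} ≤ ε := by
  obtain ⟨W₀', hW₀', hW'⟩ := exists_closedBall_superset_plateBox Φ
  set W₀ : ℝ := W₀' + 1 with hW₀def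
  have hW₀ : 0 < W₀ := by positivity
  have hW : Φ '' plateBox 2 2 ⊆ ball (0 : ℂ) W₀ :=
    hW'.trans (closedBall_subset_ball (by linarith))
  obtain ⟨αO, cO, hαO, hcO, hO⟩ := annulusOpenCrossing_half_le_holds
  obtain ⟨αD, cD, hαD, hcD, hD⟩ := annulusDualCrossing_half_le_holds
  obtain ⟨αT, hαT, hT⟩ := tri_annulusCrossing_bound_holds
  have hε2 : 0 < ε / 2 := by positivity
  obtain ⟨tO, htO, hsmallO⟩ := exists_pos_forall_rpow_lt hαO hε2
  obtain ⟨tD, htD, hsmallD⟩ := exists_pos_forall_rpow_lt hαD hε2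
  obtain ⟨tT, htT, hsmallT⟩ := exists_pos_forall_rpow_lt hαT hε2
  set s : ℝ := min (min (tO / 2) (tD / 2)) (min (tT / 2) (1 / 2)) with hsdef
  have hs : 0 < s := lt_min (lt_min (by positivity) (by positivity)) (lt_min (by positivity) (by norm_num))
  have hsO : s < tO := by
    have : s ≤ tO / 2 := (min_le_left _ _).trans (min_le_left _ _)
    linarith
  have hsD : s < tD := by
    have : s ≤ tD / 2 := (min_le_left _ _).trans (min_le_right _ _)
    linarith
  have hsT : s < tT := by
    have : s ≤ tT / 2 := (min_le_right _ _).trans (min_le_left _ _)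
    linarith
  have hs2 : s ≤ 1 / 2 := (min_le_right _ _).trans (min_le_right _ _)
  set W₁ : ℝ := W₀ / s with hW₁def
  have hW₁pos : 0 < W₁ := div_pos hW₀ hs
  have hratio : W₀ / W₁ = s := by
    rw [hW₁def]
    field_simp
  have h2W : 2 * W₀ ≤ W₁ := by
    rw [hW₁def, le_div_iff₀ hs]
    nlinarith
  have hW₀₁ : W₀ < W₁ := by linarith
  refine ⟨W₀, W₁, hW₀, hW₀₁, hW, min (min (W₀ / cO) (W₀ / cD)) (W₀ / 1000),
    lt_min (lt_min (div_pos hW₀ hcO) (div_pos hW₀ hcD)) (by positivity), fun δ hδ hδle => ?_⟩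
  have hδO : cO * δ ≤ W₀ := by
    have : δ ≤ W₀ / cO := hδle.trans ((min_le_left _ _).trans (min_le_left _ _))
    rwa [le_div_iff₀ hcO, mul_comm] at this
  have hδD : cD * δ ≤ W₀ := by
    have : δ ≤ W₀ / cD := hδle.trans ((min_le_left _ _).trans (min_le_right _ _))
    rwa [le_div_iff₀ hcD, mul_comm] at this
  have hδT : 1000 * δ ≤ W₀ := by
    have : δ ≤ W₀ / 1000 := hδle.trans (min_le_right _ _)
    rwa [le_div_iff₀ (by norm_num : (0:ℝ) < 1000), mul_comm] at this
  have bO : (bondPercolation (zdGraph 2) half).real (annulusOpenCrossing 0 δ W₀ W₁) ≤ ε / 2 := by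
    refine (hO 0 δ W₀ W₁ hδ hδO h2W).trans ?_
    rw [hratio]
    exact (hsmallO s ⟨hs, hsO⟩).le
  have bD : (bondPercolation (zdGraph 2) half).real (annulusDualCrossing 0 δ W₀ W₁) ≤ ε / 2 := by
    refine (hD 0 δ W₀ W₁ hδ hδD h2W).trans ?_
    rw [hratio]
    exact (hsmallD s ⟨hs, hsD⟩).le
  have bT : ∀ c : Bool, (triSitePercolation half).real (triAnnulusCrossing c δ 0 W₀ W₁) ≤ ε / 2 := fun c => by
    refine (hT c δ 0 W₀ W₁ hδ hδT h2W).trans ?_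
    rw [hratio]
    exact (hsmallT s ⟨hs, hsT⟩).le
  constructor
  · have hsub : {ω : BondConfig (Site 2) | ¬ (ω ∉ annulusOpenCrossing 0 δ W₀ W₁ ∧ ω ∉ annulusDualCrossing 0 δ W₀ W₁)} ⊆
        annulusOpenCrossing 0 δ W₀ W₁ ∪ annulusDualCrossing 0 δ W₀ W₁ := by
      intro ω hω
      simp only [mem_setOf_eq, not_and_or, not_not] at hω
      exact hω
    refine (measureReal_mono hsub).trans ((measureReal_union_le _ _).trans ?_)
    linarith
  · have hsub : {ω : SiteConfig (Site 2) | ¬ (ω ∉ triAnnulusCrossing true δ 0 W₀ W₁ ∧ ω ∉ triAnnulusCrossing false δ 0 W₀ W₁)} ⊆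
        triAnnulusCrossing true δ 0 W₀ W₁ ∪ triAnnulusCrossing false δ 0 W₀ W₁ := by
      intro ω hω
      simp only [mem_setOf_eq, not_and_or, not_not] at hω
      exact hω
    refine (measureReal_mono hsub).trans ((measureReal_union_le _ _).trans ?_)
    linarith [bT true, bT false]

end Literature.Probability.Percolation

end
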